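import Mathlib
import Summits.ResolutionOfSingularities.ResolutionOfSingularities.Theorems.SyzygyFlatteningHigherRankTerminationMinorEmbeddingIndep
import HarnessLib

/-!
# Maximal minors of an embedding with torsion cokernel: adding a free summand

Stub `stub_minor_freeSummand` of crux `HigherRankTermination`
(stmt-ResolutionOfSingularities-17045), line `birth`: pure linear algebra, no tower vocabulary.

Let `R` be a commutative ring whose structure map to a field `K` is injective (so `R` is a
domain), `M` an `R`-module, `ι : M →ₗ[R] (Fin r → R)` an injective linear map with torsion
cokernel and `ι' : M × (Fin s → R) →ₗ[R] (Fin r' → R)` ANY injective linear map with torsion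
cokernel on the module with a free summand added. Then `r' = r + s` and the `R`-span (inside `K`)
of the maximal minors `det (algebraMap R K (ι' (g' i) j))ᵢⱼ`, `g' : Fin r' → M × (Fin s → R)`, is
`c •` the `R`-span of the maximal minors `det (algebraMap R K (ι (g i) j))ᵢⱼ`, `g : Fin r → M`,
for ONE non-zero constant `c ∈ K`.

Proof.
* `r' = r + s` (`minorFreeSummand_rank_eq`): an injective `κ : N →ₗ[R] (Fin t → R)` with
  torsion cokernel forces `Module.rank R N = t` (`≤` by injectivity, `≥` because preimages of
  `A • Pi.single j 1`, `A ≠ 0`, are linearly independent); apply to `ι'` and to the block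
  embedding `κ₀ (m, f) = Fin.append (ι m) f` of `M × (Fin s → R)` into `Fin (r + s) → R`
  (`minorFreeSummand_exists_append`, `minorFreeSummand_append_props`).
* By the landed sibling `stub_minor_embedding_indep` (two embeddings into the SAME `R^{r+s}`
  have proportional minors) it suffices to treat `ι' = κ₀` with `c = 1`.
* `⊇`: on the tuple `((g i, 0))ᵢ ++ ((0, e_l))ₗ` the `κ₀`-matrix is block diagonal
  `fromBlocks (ι-matrix of g) 0 0 1` after reindexing by `finSumFinEquiv`
  (`minorFreeSummand_det_append_block`).
* `⊆`: Laplace expansion along the last (free) column and induction on `s`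
  (`minorFreeSummand_det_append_mem_span`): every cofactor is again a `κ₀`-minor for `s - 1`,
  and the entries of the free columns lie in `R`.
-/

noncomputable section

set_option linter.dupNamespace false

namespace Summit.ResolutionOfSingularities.ResolutionOfSingularities.Theorems.SyzygyFlattening

/-- **Uniform denominator.** If `κ : N →ₗ[R] (Fin t → R)` has torsion cokernel over a domain,
then ONE non-zero `A : R` multiplies all of `Fin t → R` into the range of `κ` (take the product
of the denominators of the standard basis vectors). [folklore] -/
theorem minorFreeSummand_exists_uniform_denom (R : Type) [CommRing R] [IsDomain R]
    (N : Type) [AddCommGroup N] [Module R N] (t : ℕ) (κ : N →ₗ[R] (Fin t → R))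
    (hT : ∀ z : Fin t → R, ∃ a : R, a ≠ 0 ∧ a • z ∈ LinearMap.range κ) :
    ∃ A : R, A ≠ 0 ∧ ∀ z : Fin t → R, A • z ∈ LinearMap.range κ := by
  classical
  choose a ha hmem using fun j : Fin t => hT (Pi.single j 1)
  refine ⟨∏ j, a j, Finset.prod_ne_zero_iff.mpr fun j _ => ha j, fun z => ?_⟩
  have hz : (∏ j, a j) • z =
      ∑ j, (z j * ∏ i ∈ Finset.univ.erase j, a i) • (a j • Pi.single j (1 : R)) := by
    funext l
    simp only [Pi.smul_apply, smul_eq_mul, Finset.sum_apply, Pi.single_apply, mul_ite, mul_one,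
      mul_zero, Finset.sum_ite_eq, Finset.mem_univ, if_true]
    rw [← Finset.prod_erase_mul Finset.univ a (Finset.mem_univ l)]
    ring
  rw [hz]
  exact Submodule.sum_mem _ fun j _ => Submodule.smul_mem _ _ (hmem j)

/-- **Rank of a module with a torsion-cokernel embedding.** If `κ : N →ₗ[R] (Fin t → R)` is
injective with torsion cokernel over a domain `R`, then `Module.rank R N = t`. [folklore] -/
theorem minorFreeSummand_rank_eq (R : Type) [CommRing R] [IsDomain R]
    (N : Type) [AddCommGroup N] [Module R N] (t : ℕ) (κ : N →ₗ[R] (Fin t → R))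
    (hκ : Function.Injective κ)
    (hT : ∀ z : Fin t → R, ∃ a : R, a ≠ 0 ∧ a • z ∈ LinearMap.range κ) :
    Module.rank R N = t := by
  classical
  apply le_antisymm
  · exact (LinearMap.rank_le_of_injective κ hκ).trans_eq (rank_fin_fun t)
  · obtain ⟨A, hA, hAT⟩ := minorFreeSummand_exists_uniform_denom R N t κ hT
    choose n hn using fun j : Fin t => LinearMap.mem_range.1 (hAT (Pi.single j 1))
    have hli : LinearIndependent R n := by
      apply LinearIndependent.of_comp κ
      have h : ⇑κ ∘ n = fun j => Pi.single j A := by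
        funext j
        rw [Function.comp_apply, hn, ← Pi.single_smul, smul_eq_mul, mul_one]
      rw [h]
      exact Pi.linearIndependent_single_of_ne_zero fun _ => hA
    simpa using hli.cardinal_le_rank

/-- **Rank invariance.** Two injective linear maps `κ : N →ₗ[R] (Fin t → R)` and
`κ' : N →ₗ[R] (Fin t' → R)` with torsion cokernels over a domain have `t = t'`. [folklore] -/
theorem minorFreeSummand_eq_of_two_embeddings (R : Type) [CommRing R] [IsDomain R]
    (N : Type) [AddCommGroup N] [Module R N] (t t' : ℕ) (κ : N →ₗ[R] (Fin t → R))
    (κ' : N →ₗ[R] (Fin t' → R)) (hκ : Function.Injective κ) (hκ' : Function.Injective κ')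
    (hT : ∀ z : Fin t → R, ∃ a : R, a ≠ 0 ∧ a • z ∈ LinearMap.range κ)
    (hT' : ∀ z : Fin t' → R, ∃ a : R, a ≠ 0 ∧ a • z ∈ LinearMap.range κ') : t = t' := by
  have h1 := minorFreeSummand_rank_eq R N t κ hκ hT
  have h2 := minorFreeSummand_rank_eq R N t' κ' hκ' hT'
  rw [h1] at h2
  exact_mod_cast h2

/-- **The block embedding exists.** For `ι : M →ₗ[R] (Fin r → R)` the map
`(m, f) ↦ Fin.append (ι m) f` is an `R`-linear map `M × (Fin s → R) →ₗ[R] (Fin (r + s) → R)`.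
[folklore] -/
theorem minorFreeSummand_exists_append (R : Type) [CommRing R] (M : Type) [AddCommGroup M]
    [Module R M] (r s : ℕ) (ι : M →ₗ[R] (Fin r → R)) :
    ∃ κ₀ : (M × (Fin s → R)) →ₗ[R] (Fin (r + s) → R), ∀ p, κ₀ p = Fin.append (ι p.1) p.2 := by
  refine ⟨{ toFun := fun p => Fin.append (ι p.1) p.2, map_add' := ?_, map_smul' := ?_ },
    fun p => rfl⟩
  · intro p q
    funext l
    refine Fin.addCases (fun i => ?_) (fun j => ?_) l <;> simp
  · intro c p
    funext l
    refine Fin.addCases (fun i => ?_) (fun j => ?_) l <;> simp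

/-- **The block embedding is an embedding with torsion cokernel.** If `ι` is injective with
torsion cokernel, so is `(m, f) ↦ Fin.append (ι m) f`. [folklore] -/
theorem minorFreeSummand_append_props (R : Type) [CommRing R] (M : Type) [AddCommGroup M]
    [Module R M] (r s : ℕ) (ι : M →ₗ[R] (Fin r → R)) (hι : Function.Injective ι)
    (hT : ∀ z : Fin r → R, ∃ a : R, a ≠ 0 ∧ a • z ∈ LinearMap.range ι)
    (κ₀ : (M × (Fin s → R)) →ₗ[R] (Fin (r + s) → R))
    (hκ₀ : ∀ p, κ₀ p = Fin.append (ι p.1) p.2) :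
    Function.Injective κ₀ ∧
      ∀ z : Fin (r + s) → R, ∃ a : R, a ≠ 0 ∧ a • z ∈ LinearMap.range κ₀ := by
  constructor
  · intro p q hpq
    rw [hκ₀, hκ₀] at hpq
    have h1 : ι p.1 = ι q.1 := by
      funext i
      simpa using congrFun hpq (Fin.castAdd s i)
    have h2 : p.2 = q.2 := by
      funext j
      simpa using congrFun hpq (Fin.natAdd r j)
    exact Prod.ext (hι h1) h2
  · intro z
    obtain ⟨a, ha, m, hm⟩ := hT fun i => z (Fin.castAdd s i)
    refine ⟨a, ha, (m, fun j => a * z (Fin.natAdd r j)), ?_⟩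
    rw [hκ₀]
    funext l
    refine Fin.addCases (fun i => ?_) (fun j => ?_) l
    · simp only [Fin.append_left, hm, Pi.smul_apply, smul_eq_mul]
    · simp only [Fin.append_right, Pi.smul_apply, smul_eq_mul]

/-- **Block-diagonal minor.** On the tuple `g' = ((g i, 0))ᵢ ++ ((0, Pi.single l 1))ₗ` the
matrix of the block embedding is `fromBlocks (ι-matrix of g) 0 0 1` up to reindexing by
`finSumFinEquiv`, so its determinant is the `ι`-minor of `g`. [folklore] -/
theorem minorFreeSummand_det_append_block (R K : Type) [CommRing R] [Field K] [Algebra R K]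
    (M : Type) [AddCommGroup M] [Module R M] (r s : ℕ) (ι : M →ₗ[R] (Fin r → R))
    (g : Fin r → M) (g' : Fin (r + s) → M × (Fin s → R))
    (h₁ : ∀ i, g' (Fin.castAdd s i) = (g i, 0))
    (h₂ : ∀ l, g' (Fin.natAdd r l) = (0, Pi.single l 1)) :
    Matrix.det (Matrix.of fun i j => algebraMap R K (Fin.append (ι (g' i).1) (g' i).2 j)) =
      Matrix.det (Matrix.of fun i j => algebraMap R K (ι (g i) j)) := by
  classical
  rw [← Matrix.det_reindex_self finSumFinEquiv.symm
    (Matrix.of fun i j => algebraMap R K (Fin.append (ι (g' i).1) (g' i).2 j))]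
  have h : Matrix.reindex finSumFinEquiv.symm finSumFinEquiv.symm
      (Matrix.of fun i j => algebraMap R K (Fin.append (ι (g' i).1) (g' i).2 j)) =
      Matrix.fromBlocks (Matrix.of fun i j => algebraMap R K (ι (g i) j)) 0 0 1 := by
    ext (i | l) (j | l')
    · simp [h₁]
    · simp [h₁]
    · simp [h₂]
    · by_cases hl : l = l'
      · subst hl
        simp [h₂]
      · simp [h₂, hl, Ne.symm hl]
  rw [h, Matrix.det_fromBlocks_zero₂₁, Matrix.det_one, mul_one]

/-- Evaluating `Fin.append u v` at the last index picks the last entry of `v`. -/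
theorem minorFreeSummand_append_last {α : Type} (r s : ℕ) (u : Fin r → α) (v : Fin (s + 1) → α) :
    Fin.append u v (Fin.last (r + s)) = v (Fin.last s) := by
  rw [← Fin.natAdd_last, Fin.append_right]

/-- Evaluating `Fin.append u v` below the last index is `Fin.append u (Fin.init v)`. -/
theorem minorFreeSummand_append_castSucc {α : Type} (r s : ℕ) (u : Fin r → α)
    (v : Fin (s + 1) → α) (b : Fin (r + s)) :
    Fin.append u v (Fin.castSucc b) = Fin.append u (Fin.init v) b := by
  conv_lhs => rw [← Fin.snoc_init_self v]
  rw [Fin.append_snoc]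
  exact Fin.snoc_castSucc (α := fun _ => α) _ _ _

/-- **Laplace along the free columns.** Every maximal minor of the block embedding
`(m, f) ↦ Fin.append (ι m) f` on an `(r + s)`-tuple of elements of `M × (Fin s → R)` lies in the
`R`-span of the maximal minors of `ι` on `r`-tuples of elements of `M` (expand along the last
column, whose entries lie in `R`, and induct on `s`). [folklore] -/
theorem minorFreeSummand_det_append_mem_span (R K : Type) [CommRing R] [Field K] [Algebra R K]
    (M : Type) [AddCommGroup M] [Module R M] (r : ℕ) (ι : M →ₗ[R] (Fin r → R)) :
    ∀ (s : ℕ) (g' : Fin (r + s) → M × (Fin s → R)),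
      Matrix.det (Matrix.of fun i j => algebraMap R K (Fin.append (ι (g' i).1) (g' i).2 j)) ∈
        Submodule.span R (Set.range fun g : Fin r → M =>
          Matrix.det (Matrix.of fun i j => algebraMap R K (ι (g i) j))) := by
  intro s
  induction s with
  | zero =>
    intro g'
    change Matrix.det (Matrix.of fun (i : Fin r) (j : Fin r) =>
        algebraMap R K (Fin.append (ι (g' i).1) (g' i).2 j)) ∈ _
    refine Submodule.subset_span ⟨fun i => (g' i).1, ?_⟩
    change Matrix.det (Matrix.of fun (i : Fin r) (j : Fin r) => algebraMap R K (ι (g' i).1 j)) = _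
    congr 1
    ext i j
    simp only [Matrix.of_apply]
    rw [Fin.append_right_nil _ _ rfl, Function.comp_apply]
    rfl
  | succ s ih =>
    intro g'
    change Matrix.det (Matrix.of fun (i : Fin (r + s + 1)) (j : Fin (r + s + 1)) =>
        algebraMap R K (Fin.append (ι (g' i).1) (g' i).2 j)) ∈ _
    rw [Matrix.det_succ_column _ (Fin.last (r + s))]
    refine Submodule.sum_mem _ fun i _ => ?_
    have hsub : (Matrix.of fun (i : Fin (r + s + 1)) (j : Fin (r + s + 1)) =>
        algebraMap R K (Fin.append (ι (g' i).1) (g' i).2 j)).submatrix i.succAbove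
          (Fin.last (r + s)).succAbove =
        Matrix.of fun a b => algebraMap R K (Fin.append (ι (g' (i.succAbove a)).1)
          (Fin.init (g' (i.succAbove a)).2) b) := by
      ext a b
      simp only [Matrix.submatrix_apply, Matrix.of_apply, Fin.succAbove_last]
      rw [minorFreeSummand_append_castSucc]
    have hmem := ih fun a => ((g' (i.succAbove a)).1, Fin.init (g' (i.succAbove a)).2)
    rw [hsub, Matrix.of_apply, minorFreeSummand_append_last]
    have key : (-1 : K) ^ (i + Fin.last (r + s) : ℕ) * algebraMap R K ((g' i).2 (Fin.last s)) *
        Matrix.det (Matrix.of fun a b => algebraMap R K (Fin.append (ι (g' (i.succAbove a)).1)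
          (Fin.init (g' (i.succAbove a)).2) b)) =
        ((-1 : R) ^ (i + Fin.last (r + s) : ℕ) * (g' i).2 (Fin.last s)) •
          Matrix.det (Matrix.of fun a b => algebraMap R K
            (Fin.append (ι (g' (i.succAbove a)).1) (Fin.init (g' (i.succAbove a)).2) b)) := by
      rw [Algebra.smul_def, map_mul, map_pow, map_neg, map_one]
    rw [key]
    exact Submodule.smul_mem _ _ hmem

/-- **STUB `stub_minor_freeSummand`.** Adding a free summand does not change the span of the
maximal minors up to a unit of `K`: for `ι : M ↪ R^r` injective with torsion cokernel and ANY
injective `ι' : M × R^s ↪ R^{r'}` with torsion cokernel, `r' = r + s` (rank) and the `R`-span of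
the maximal minors of `ι'` on `r'`-tuples is `c ·` the `R`-span of the maximal minors of `ι` on
`r`-tuples, `c ∈ K^×` (change of embedding by `stub_minor_embedding_indep`, then Laplace
expansion along the free columns). [folklore] -/
theorem stub_minor_freeSummand : ∀ (R K : Type) [CommRing R] [Field K] [Algebra R K],
    Function.Injective (algebraMap R K) →
    ∀ (M : Type) [AddCommGroup M] [Module R M] (r s r' : ℕ) (ι : M →ₗ[R] (Fin r → R))
      (ι' : (M × (Fin s → R)) →ₗ[R] (Fin r' → R)),
      Function.Injective ι → Function.Injective ι' →
      (∀ z : Fin r → R, ∃ a : R, a ≠ 0 ∧ a • z ∈ LinearMap.range ι) →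
      (∀ z : Fin r' → R, ∃ a : R, a ≠ 0 ∧ a • z ∈ LinearMap.range ι') →
      ∃ c : K, c ≠ 0 ∧
        Submodule.span R (Set.range fun g' : Fin r' → M × (Fin s → R) =>
            Matrix.det (Matrix.of fun i j => algebraMap R K (ι' (g' i) j))) =
          (Submodule.span R (Set.range fun g : Fin r → M =>
            Matrix.det (Matrix.of fun i j => algebraMap R K (ι (g i) j)))).map
            (LinearMap.mulLeft R c) := by
  intro R K _ _ _ hRK M _ _ r s r' ι ι' hι hι' htor htor'
  classical
  haveI : IsDomain R := Function.Injective.isDomain (algebraMap R K) hRK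
  obtain ⟨κ₀, hκ₀⟩ := minorFreeSummand_exists_append R M r s ι
  obtain ⟨hκ₀inj, hκ₀tor⟩ := minorFreeSummand_append_props R M r s ι hι htor κ₀ hκ₀
  obtain rfl : r' = r + s :=
    minorFreeSummand_eq_of_two_embeddings R (M × (Fin s → R)) r' (r + s) ι' κ₀ hι' hκ₀inj htor'
      hκ₀tor
  obtain ⟨c, hc, hdet⟩ :=
    stub_minor_embedding_indep R K hRK (M × (Fin s → R)) (r + s) κ₀ ι' hκ₀inj hι' hκ₀tor htor'
  refine ⟨c, hc, ?_⟩
  have hB : Submodule.span R (Set.range fun g' : Fin (r + s) → M × (Fin s → R) =>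
      Matrix.det (Matrix.of fun i j => algebraMap R K (κ₀ (g' i) j))) =
      Submodule.span R (Set.range fun g : Fin r → M =>
        Matrix.det (Matrix.of fun i j => algebraMap R K (ι (g i) j))) := by
    apply le_antisymm
    · rw [Submodule.span_le]
      rintro _ ⟨g', rfl⟩
      simp only [hκ₀]
      exact minorFreeSummand_det_append_mem_span R K M r ι s g'
    · apply Submodule.span_mono
      rintro _ ⟨g, rfl⟩
      refine ⟨Fin.append (fun i => (g i, (0 : Fin s → R)))
        (fun l => ((0 : M), Pi.single l (1 : R))), ?_⟩
      simp only [hκ₀]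
      exact minorFreeSummand_det_append_block R K M r s ι g _ (fun i => by simp)
        (fun l => by simp)
  have hfun : (fun g' : Fin (r + s) → M × (Fin s → R) =>
      Matrix.det (Matrix.of fun i j => algebraMap R K (ι' (g' i) j))) =
      ⇑(LinearMap.mulLeft R c) ∘ fun g' =>
        Matrix.det (Matrix.of fun i j => algebraMap R K (κ₀ (g' i) j)) := by
    funext g'
    rw [Function.comp_apply, LinearMap.mulLeft_apply]
    exact hdet g'
  rw [← hB, Submodule.map_span, ← Set.range_comp, ← hfun]

end Summit.ResolutionOfSingularities.ResolutionOfSingularities.Theorems.SyzygyFlattening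

end
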